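import Summits.NavierStokesRegularity.NavierStokesRegularity.Theorems.HodographBetchovSlowClassProductionLifespan
import Summits.NavierStokesRegularity.NavierStokesRegularity.Theorems.HodographBetchovSlowClassProductionStubCurlBoundedProduction
import Summits.NavierStokesRegularity.NavierStokesRegularity.Theorems.HodographBetchovSlowClassProductionStubFarFieldVelocity

/-!
# `SlowClassProduction` (stmt-NavierStokesRegularity-15831), line `near_field` — the crux reduced to the near-field final layer

Route `HodographBetchov`, crux 2.  With stubs 1 and 2 of the registered strategist skeleton
`Cruxes/SlowClassProduction/Lines/near_field.lean` landed as theorems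
(`NearField.stub_curlBoundedProduction`, p153732; `NearField.stub_farFieldVelocity`, p153561), the
early / near / far split of the slow class reduces the crux EXACTLY to the line's load-bearing stub
`stub_nearFieldSlowProductionMaximal`: the absolute production budget of the slow class inside a
near-field final layer `{T − h ≤ s} × {‖x‖ < R}` of a MAXIMAL smooth solution.  This file records the
reduction as theorems of the tree:

* `slowClassBudget_of_nearFieldBudget` — PER SOLUTION (classical, Leray–Hopf, decaying datum; no
  maximality needed) and per level `l`: near-field budgets for all layers `(h, R)` ⇒ the slow-class
  budget at level `l`;
* `slowClassProduction_of_nearFieldBudget : (statement of stub 3) → SlowClassProduction`, through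
  `slowClassProduction_iff_maximal` — a proof of the near-field stub closes the crux in one line.

The glue is the planner's sorry-free composition `maximalCase_of_stubs` of the skeleton (split
`S_t = early ∪ late-near ∪ late-far`; the far piece has slow backward `(h/2, r)`-cylinders at the
far-field level `L`, hence bounded vorticity by Serrin's quantitative bound
`Birth.norm_curl_le_of_slow_cylinder`, and is paid by stub 1; the early piece by the landed slab
theorem `Birth.stub_slabProduction`), reproduced with the two landed stubs plugged in and without
auxiliary definitions (the skeleton file carries the open stub as a `sorry` and is not importable).
-/

noncomputable section

-- the summit and its single problem share the name `NavierStokesRegularity` (D-0017 nested layout)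
set_option linter.dupNamespace false

namespace Summit.NavierStokesRegularity.NavierStokesRegularity.Theorems.SlowClassProduction.NearField

open Set MeasureTheory Metric
open scoped ContDiff

/-- A point of the closed `r`-ball around `x` with `R + r ≤ ‖x‖` lies outside the open `R`-ball.
(Planner's glue lemma of `Lines/near_field.lean`.) [folklore] -/
theorem le_norm_of_mem_closedBall {x y : EuclideanSpace ℝ (Fin 3)} {R r : ℝ}
    (hx : R + r ≤ ‖x‖) (hy : y ∈ Metric.closedBall x r) : R ≤ ‖y‖ := by
  rw [Metric.mem_closedBall, dist_comm, dist_eq_norm] at hy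
  have h := norm_sub_norm_le x y
  linarith

/-- **Near-field budgets pay the slow-class budget (per solution, per level).**  For `ν, T > 0`, a
classical solution `(u,p)` of unforced Navier–Stokes on `ℝ³ × [0,T)` that is Leray–Hopf on `[0,T]`
from its rapidly decaying datum, and a level `l`: if for every layer thickness `h ∈ (0,T)` and radius
`R` the production `P = ⟪ω, ∇u ω⟫` is absolutely integrable on the slow class inside the near-field
final layer `{T − h ≤ s} × {‖x‖ < R}` with `∫ |P| ≤ C(h,R)` uniformly in `t < T`, then the slow class
`S_t = {0 < s < t, |u| ≤ l}` carries `P` integrably with `∫_{S_t} P ≤ C` uniformly in `t < T`.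
Proof (the glue of `Lines/near_field.lean`): far-field data `(h, R, L)` from
`stub_farFieldVelocity`; `r = √(ν h/2)`; the vorticity bound `K` on slow `(h/2, r)`-cylinders at
level `L` (`Birth.norm_curl_le_of_slow_cylinder`); the absolute budget `C₂` on `{‖ω‖ ≤ K}`
(`stub_curlBoundedProduction`); the hypothesis at `(h/2, R + r)`; the slab budget on
`(0, T − h/2) × ℝ³` (`Birth.stub_slabProduction`); split `S_t` twice (`integral_inter_add_sdiff`). -/
theorem slowClassBudget_of_nearFieldBudget {ν T : ℝ} (hν : 0 < ν) (hT : 0 < T)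
    {u : ℝ → EuclideanSpace ℝ (Fin 3) → EuclideanSpace ℝ (Fin 3)}
    {p : ℝ → EuclideanSpace ℝ (Fin 3) → ℝ}
    (hcl : Literature.Analysis.FluidPDE.IsClassicalNSSolutionOn (Set.Ico 0 T) ν 0 u p)
    (hLH : Literature.Analysis.FluidPDE.IsLerayHopfOn T ν 0 (u 0) u)
    (hdec : Literature.Analysis.FluidPDE.HasRapidSpatialDecay (u 0)) {l : ℝ}
    (hnear : ∀ h : ℝ, 0 < h → h < T → ∀ R : ℝ, ∃ C : ℝ, ∀ t ∈ Set.Ico 0 T,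
      MeasureTheory.IntegrableOn
        (fun z : ℝ × EuclideanSpace ℝ (Fin 3) =>
          inner ℝ (Literature.Analysis.FluidPDE.curl (u z.1) z.2)
            (fderiv ℝ (u z.1) z.2 (Literature.Analysis.FluidPDE.curl (u z.1) z.2)))
        ({z : ℝ × EuclideanSpace ℝ (Fin 3) | z.1 ∈ Set.Ioo 0 t ∧ ‖u z.1 z.2‖ ≤ l} ∩
          {z : ℝ × EuclideanSpace ℝ (Fin 3) | T - h ≤ z.1 ∧ ‖z.2‖ < R}) ∧
      ∫ z in ({z : ℝ × EuclideanSpace ℝ (Fin 3) | z.1 ∈ Set.Ioo 0 t ∧ ‖u z.1 z.2‖ ≤ l} ∩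
          {z : ℝ × EuclideanSpace ℝ (Fin 3) | T - h ≤ z.1 ∧ ‖z.2‖ < R}),
        |inner ℝ (Literature.Analysis.FluidPDE.curl (u z.1) z.2)
          (fderiv ℝ (u z.1) z.2 (Literature.Analysis.FluidPDE.curl (u z.1) z.2))| ≤ C) :
    ∃ C : ℝ, ∀ t ∈ Set.Ico 0 T,
      MeasureTheory.IntegrableOn
        (fun z : ℝ × EuclideanSpace ℝ (Fin 3) =>
          inner ℝ (Literature.Analysis.FluidPDE.curl (u z.1) z.2)
            (fderiv ℝ (u z.1) z.2 (Literature.Analysis.FluidPDE.curl (u z.1) z.2)))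
        {z : ℝ × EuclideanSpace ℝ (Fin 3) | z.1 ∈ Set.Ioo 0 t ∧ ‖u z.1 z.2‖ ≤ l} ∧
      ∫ z in {z : ℝ × EuclideanSpace ℝ (Fin 3) | z.1 ∈ Set.Ioo 0 t ∧ ‖u z.1 z.2‖ ≤ l},
        inner ℝ (Literature.Analysis.FluidPDE.curl (u z.1) z.2)
          (fderiv ℝ (u z.1) z.2 (Literature.Analysis.FluidPDE.curl (u z.1) z.2)) ≤ C := by
  -- notation
  set P : ℝ × EuclideanSpace ℝ (Fin 3) → ℝ := fun z =>
    inner ℝ (Literature.Analysis.FluidPDE.curl (u z.1) z.2)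
      (fderiv ℝ (u z.1) z.2 (Literature.Analysis.FluidPDE.curl (u z.1) z.2)) with hP_def
  set S : ℝ → Set (ℝ × EuclideanSpace ℝ (Fin 3)) := fun t =>
    {z : ℝ × EuclideanSpace ℝ (Fin 3) | z.1 ∈ Set.Ioo 0 t ∧ ‖u z.1 z.2‖ ≤ l} with hS_def
  -- far-field data
  obtain ⟨h, hh0, hhT, R, L, hfar⟩ := stub_farFieldVelocity ν T hν hT u p hcl hLH hdec
  -- the cylinder radius `r` with `r² / ν = h / 2`
  set r : ℝ := Real.sqrt (ν * (h / 2)) with hr_def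
  have hνh : 0 ≤ ν * (h / 2) := by positivity
  have hr0 : 0 < r := Real.sqrt_pos.mpr (by positivity)
  have hr2 : r ^ 2 / ν = h / 2 := by
    rw [hr_def, Real.sq_sqrt hνh]
    field_simp
  -- finite dissipation and Serrin's quantitative vorticity bound at level `L`, radius `r`
  have hD := (Literature.Analysis.FluidPDE.IsLerayHopfOn.lintegral_frobeniusNormSq_fderiv_of_classical
    hcl hLH hT).1
  obtain ⟨K, hK⟩ := Birth.norm_curl_le_of_slow_cylinder ν T hν u p hcl hD L r hr0
  -- the three budgets
  obtain ⟨C₂, hbdd⟩ := stub_curlBoundedProduction ν T hν hT u p hcl hLH hdec K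
  have hh20 : 0 < h / 2 := by positivity
  have hh2T : h / 2 < T := by linarith
  obtain ⟨C₄, hnear4⟩ := hnear (h / 2) hh20 hh2T (R + r)
  have hTh0 : 0 < T - h / 2 := by linarith
  have hThT : T - h / 2 < T := by linarith
  have hI : IntegrableOn P (Set.Ioo 0 (T - h / 2) ×ˢ (Set.univ : Set (EuclideanSpace ℝ (Fin 3)))) :=
    Birth.stub_slabProduction ν T hν hT u p hcl hLH hdec (T - h / 2) hTh0 hThT
  refine ⟨(∫ z in Set.Ioo 0 (T - h / 2) ×ˢ (Set.univ : Set (EuclideanSpace ℝ (Fin 3))), |P z|) +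
    C₄ + C₂, ?_⟩
  intro t ht
  change IntegrableOn P (S t) ∧ ∫ z in S t, P z ≤ _
  -- the two measurable cuts
  set A : Set (ℝ × EuclideanSpace ℝ (Fin 3)) := {z | z.1 < T - h / 2} with hAdef
  set B : Set (ℝ × EuclideanSpace ℝ (Fin 3)) := {z | ‖z.2‖ < R + r} with hBdef
  have hA : MeasurableSet A := measurableSet_lt measurable_fst measurable_const
  have hB : MeasurableSet B := measurableSet_lt measurable_snd.norm measurable_const
  -- piece 1: early, inside the slab `(0, T - h/2) × ℝ³`
  have hsub : S t ∩ A ⊆ Set.Ioo 0 (T - h / 2) ×ˢ (Set.univ : Set (EuclideanSpace ℝ (Fin 3))) := by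
    rintro z ⟨⟨hzt, _⟩, hza⟩
    exact Set.mk_mem_prod ⟨hzt.1, hza⟩ (Set.mem_univ _)
  have hIA : IntegrableOn P (S t ∩ A) := hI.mono_set hsub
  -- piece 2: late near field = the hypothesis' set at `(h/2, R + r)`
  have hNt : IntegrableOn P (S t ∩ {z : ℝ × EuclideanSpace ℝ (Fin 3) | T - h / 2 ≤ z.1 ∧ ‖z.2‖ < R + r}) ∧
      ∫ z in S t ∩ {z : ℝ × EuclideanSpace ℝ (Fin 3) | T - h / 2 ≤ z.1 ∧ ‖z.2‖ < R + r}, |P z| ≤ C₄ :=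
    hnear4 t ht
  have hNeq : (S t \ A) ∩ B = S t ∩ {z : ℝ × EuclideanSpace ℝ (Fin 3) | T - h / 2 ≤ z.1 ∧ ‖z.2‖ < R + r} := by
    ext z
    simp only [hS_def, hAdef, hBdef, Set.mem_inter_iff, Set.mem_sdiff, Set.mem_setOf_eq, not_lt]
    tauto
  have hIN : IntegrableOn P ((S t \ A) ∩ B) := by
    rw [hNeq]; exact hNt.1
  -- piece 3: late far field — every backward `(h/2, r)`-cylinder is slow at level `L`, so `‖ω‖ ≤ K`
  have hFhyp : ∀ z ∈ (S t \ A) \ B,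
      z.1 ∈ Set.Ioo 0 T ∧ ‖Literature.Analysis.FluidPDE.curl (u z.1) z.2‖ ≤ K := by
    intro z hz
    obtain ⟨⟨⟨hzt, _⟩, hza⟩, hzR⟩ := hz
    simp only [hAdef, hBdef, Set.mem_setOf_eq, not_lt] at hza hzR
    have hz1T : z.1 < T := lt_trans hzt.2 ht.2
    refine ⟨⟨hzt.1, hz1T⟩, hK z.1 ?_ hz1T z.2 ?_⟩
    · rw [hr2]; linarith
    · intro σ hσ y hy
      refine hfar σ ⟨?_, ?_⟩ y (le_norm_of_mem_closedBall hzR hy)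
      · have h1 := hσ.1
        rw [hr2] at h1
        linarith
      · exact lt_of_le_of_lt hσ.2 hz1T
  have hFt : IntegrableOn P ((S t \ A) \ B) ∧ ∫ z in (S t \ A) \ B, |P z| ≤ C₂ := hbdd _ hFhyp
  -- integrability on the whole slow class
  have hSA : IntegrableOn P (S t \ A) := by
    rw [← Set.inter_union_sdiff (S t \ A) B]
    exact hIN.union hFt.1
  have hSt : IntegrableOn P (S t) := by
    rw [← Set.inter_union_sdiff (S t) A]
    exact hIA.union hSA
  refine ⟨hSt, ?_⟩
  -- split the integral twice
  have e1 := integral_inter_add_sdiff hA hSt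
  have e2 := integral_inter_add_sdiff hB hSA
  -- bound the three pieces
  have b0 : ∫ z in S t ∩ A, P z ≤
      ∫ z in Set.Ioo 0 (T - h / 2) ×ˢ (Set.univ : Set (EuclideanSpace ℝ (Fin 3))), |P z| :=
    calc ∫ z in S t ∩ A, P z
        ≤ ∫ z in S t ∩ A, |P z| := integral_mono hIA hIA.abs fun z => le_abs_self _
      _ ≤ ∫ z in Set.Ioo 0 (T - h / 2) ×ˢ (Set.univ : Set (EuclideanSpace ℝ (Fin 3))), |P z| :=
          setIntegral_mono_set hI.abs (ae_of_all _ fun z => abs_nonneg _) hsub.eventuallyLE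
  have b1 : ∫ z in (S t \ A) ∩ B, P z ≤ C₄ := by
    rw [hNeq]
    exact le_trans (integral_mono hNt.1 hNt.1.abs fun z => le_abs_self _) hNt.2
  have b2 : ∫ z in (S t \ A) \ B, P z ≤ C₂ :=
    le_trans (integral_mono hFt.1 hFt.1.abs fun z => le_abs_self _) hFt.2
  rw [← e1, ← e2]
  linarith

/-- **Line `near_field` closed modulo its load-bearing stub: the near-field budget of maximal
solutions implies the crux `SlowClassProduction`.**  If for every `ν, T > 0`, every MAXIMAL smooth
solution `(u,p)` with lifespan `T` (`IsMaximalSmoothSolution ν 0 u p T`) that is Leray–Hopf from its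
rapidly decaying datum, every level `l > 0`, layer `h ∈ (0,T)` and radius `R`, the production is
absolutely integrable on the slow class inside `{T − h ≤ s} × {‖x‖ < R}` with `∫ |P| ≤ C` uniformly in
`t < T` (exactly the statement of `stub_nearFieldSlowProductionMaximal` of `Lines/near_field.lean`),
then `SlowClassProduction` holds: by `slowClassProduction_iff_maximal` only maximal solutions matter,
and for those `slowClassBudget_of_nearFieldBudget` applies. -/
theorem slowClassProduction_of_nearFieldBudget :
    (∀ (ν T : ℝ), 0 < ν → 0 < T →
      ∀ (u : ℝ → EuclideanSpace ℝ (Fin 3) → EuclideanSpace ℝ (Fin 3))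
        (p : ℝ → EuclideanSpace ℝ (Fin 3) → ℝ),
        Literature.Analysis.FluidPDE.IsMaximalSmoothSolution ν 0 u p T →
        Literature.Analysis.FluidPDE.IsLerayHopfOn T ν 0 (u 0) u →
        Literature.Analysis.FluidPDE.HasRapidSpatialDecay (u 0) →
        ∀ l : ℝ, 0 < l → ∀ h : ℝ, 0 < h → h < T → ∀ R : ℝ, ∃ C : ℝ, ∀ t ∈ Set.Ico 0 T,
          MeasureTheory.IntegrableOn
            (fun z : ℝ × EuclideanSpace ℝ (Fin 3) =>
              inner ℝ (Literature.Analysis.FluidPDE.curl (u z.1) z.2)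
                (fderiv ℝ (u z.1) z.2 (Literature.Analysis.FluidPDE.curl (u z.1) z.2)))
            ({z : ℝ × EuclideanSpace ℝ (Fin 3) | z.1 ∈ Set.Ioo 0 t ∧ ‖u z.1 z.2‖ ≤ l} ∩
              {z : ℝ × EuclideanSpace ℝ (Fin 3) | T - h ≤ z.1 ∧ ‖z.2‖ < R}) ∧
          ∫ z in ({z : ℝ × EuclideanSpace ℝ (Fin 3) | z.1 ∈ Set.Ioo 0 t ∧ ‖u z.1 z.2‖ ≤ l} ∩
              {z : ℝ × EuclideanSpace ℝ (Fin 3) | T - h ≤ z.1 ∧ ‖z.2‖ < R}),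
            |inner ℝ (Literature.Analysis.FluidPDE.curl (u z.1) z.2)
              (fderiv ℝ (u z.1) z.2 (Literature.Analysis.FluidPDE.curl (u z.1) z.2))| ≤ C) →
    Summit.NavierStokesRegularity.NavierStokesRegularity.Theses.HodographBetchov.SlowClassProduction := by
  intro hN
  refine slowClassProduction_iff_maximal.mpr ?_
  intro ν T hν hT u p hmax hLH hdec l hl
  exact slowClassBudget_of_nearFieldBudget hν hT hmax.1 hLH hdec
    (fun h hh hhT R => hN ν T hν hT u p hmax hLH hdec l hl h hh hhT R)

end Summit.NavierStokesRegularity.NavierStokesRegularity.Theorems.SlowClassProduction.NearField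

end
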